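import Summits.Ventures.CertifiedArithmetic.LowPrec.GemmThetaLawE2M1FamilyWord
import Summits.Ventures.CertifiedArithmetic.LowPrec.GemmTwoBinadeClimb
import HarnessLib

/-!
# GEMM worst case XLIX-b — the canonical E2M1² family for EVERY precision `p ≥ 2`: an explicit
# all-`n` input whose sequential-RNE relative error is `1 - 64θ_p/(64n - 691·2^{p-2} - 56)`

HONEST FRAMING: certified error envelopes and provably optimal rounding/accumulation schemes for
low-precision formats under stated cost models; every table by two implementations; no hardware or
vendor claims.

The UPPER side of the E2M1² law (gemm.tex Thm. `t:thetap` (iv)–(v)), symbolically in the precision.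
For a target format `φ` with `p = manBits φ + 1` significand bits, the quarter grid in range
(`qexp φ ≤ -2`) and `2^(manBits φ + 10) ≤ maxRat φ` (bfloat16, TF32, binary32, binary64, …; not
binary16), write `N = 2^(p-2)` (so `2^manBits = 2N`).  In QUARTER UNITS the family `fam N` (file XLIX-a, `GemmThetaLawE2M1FamilyWord`) is

  `2^{×(2N+1)}  1 | 3^{×N} | (2,3)^{×(N-1)} 2 | (6,4)^{×N} (9,8)^{×N} (18,16)^{×N} (36,32)^{×N} | 72 64 | (-64)^∞`

(values `½^{×(2N+1)} ¼ ¾^{×N} (½,¾)^{×(N-1)} ½ (3/2,1)^{×N} (9/4,2)^{×N} (9/2,4)^{×N} (9,8)^{×N} 18 16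
-16 -16 …`, every letter a product of two E2M1 data).  Its accumulator follows the explicit
piecewise-affine trajectory `traj N` (`fam_seqSum`): the `2N+1` halves are summed EXACTLY up to
`v_{0,1} = (2N+1)·½`, the `¼` is a tie resolved up to the even point `v_{0,2}`, and from there every
letter of binade `j` (spacing `2^{j+1}` quarter units on `[2N·2^{j+1}, 4N·2^{j+1})`) advances the
accumulator by exactly one grid step — the first letter of each pair exceeds the half-spacing from an
even point, the second is a half-spacing tie from an odd point resolved up (ties-to-even) — until
`v° = (2N+2)·128` quarter units, where `-64` (value `-16`) is a downward tie from an even point and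
is absorbed forever (`fam_tail`).  Prefix: `13N+3` letters, mass `L° = (141N+136)/4`, final state
`64N+64`, end deficit `2L° - v° = (26N+16)/4 = θ_p` with `θ_p = (13·2^manBits + 16)/64` the
constant of the law (`thetaP`, `e2m1Law.thetaL`).  Hence (`fam_relErr`) for every `n ≥ 13N+3`
letters the relative error is EXACTLY `(64n - 717N - 72)/(64n - 691N - 56)
= 1 - 64θ_p/(64n - 691N - 56)`; file L (`GemmWorstCaseE2M1Prec`) turns this into the upper half
of the two-sided sandwich for `W_p(n)` and the limit `n(1 - W_p(n)) → θ_p`.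

Method (no `decide` over trajectories — the precision is a symbol): the binade-step lemma
`rneSigMag_binade_step` and the quarter bridge `value_step` of file XLIX-a, a twelve-way case
analysis of the letter index closed by `omega` (`traj_step`), then the landed tie-chain assembly
`tieChain_spec` / `tieChain_inRange` for the absorbed tail.
This is the symbolic counterpart of the kernel-evaluated `bfloat16` family `e2m1_709`
(`GemmTerminalE2M1`, `p = 8`, paper prefix `144 φ̂_8`); the universal prefix `½^{×(2N+1)} ¼` used
here has the same mass and end deficit as the paper's `36^{×a_p} φ̂_p` (so the same `θ_p` and the
same limit) with a later onset (`13N+3` instead of `m°_p ≈ 11N + 2^p/144`), and avoids the six cases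
`p mod 6`.

References: the θ-law and its SUP side for every `p ≥ 8` are `thetaCert_e2m1Law`
(`GemmThetaLawGenFinal`) / `abs_err_le_E2M1_prec` (`GemmThetaLawE2M1`); explicit worst-case inputs
for recursive summation in the literature are format-by-format ([Higham2002, §4.2],
[MullerEtAl2018HFPA, §6.1]; formal FP error analysis per format in Flocq [BoldoMelquiond2011Flocq]);
no all-precision closed-form worst-case family for a fixed product alphabet is known to us
(FRESHNESS-GEMM.md, gen 14 presearch).
-/

namespace Summit.Ventures.CertifiedArithmetic.LowPrec.Gemm

open Literature.ComputerArithmetic.FloatingPoint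
open Literature.ComputerArithmetic.FloatingPoint.MiniFloat
open Literature.ComputerArithmetic.FloatingPoint.MiniFloat.TieChain (seqSum_orbitFn)
open Finset

variable {φ : Format}

section Steps

variable (hq : φ.qexp ≤ -2) (hR : (2 : ℚ) ^ (φ.manBits + 10) ≤ φ.maxRat)
  {N : ℕ} (hM : 2 ^ φ.manBits = 2 * N)
include hq hR hM

/-- THE PREFIX ROUNDINGS (twelve cases of the letter index, each one binade step):
`fl_φ(traj k + fam (k+1)) = traj (k+1)` for every `k < 13N+2`, and the step is in range. [cell] -/
theorem traj_step (k : ℕ) (hk : k < 13 * N + 2) :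
    (roundNE φ (traj N k + fam N (k + 1))).toRat = traj N (k + 1) ∧
      |traj N k + fam N (k + 1)| ≤ φ.maxRat := by
  obtain ⟨hN, hpow, hpow1⟩ := pow_facts hM
  have h2 : 2 ∣ 2 * N := ⟨N, rfl⟩
  unfold traj fam
  rcases (by omega : k + 1 ≤ 2 * N - 2 ∨ (2 * N - 1 ≤ k + 1 ∧ k + 1 ≤ 2 * N) ∨ k + 1 = 2 * N + 1 ∨
      (2 * N + 2 ≤ k + 1 ∧ k + 1 ≤ 3 * N) ∨ k + 1 = 3 * N + 1 ∨ (3 * N + 2 ≤ k + 1 ∧ k + 1 ≤ 5 * N) ∨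
      (5 * N + 1 ≤ k + 1 ∧ k + 1 ≤ 7 * N) ∨ (7 * N + 1 ≤ k + 1 ∧ k + 1 ≤ 9 * N) ∨
      (9 * N + 1 ≤ k + 1 ∧ k + 1 ≤ 11 * N) ∨ (11 * N + 1 ≤ k + 1 ∧ k + 1 ≤ 13 * N) ∨
      k + 1 = 13 * N + 1 ∨ k + 1 = 13 * N + 2) with
      h | h | h | h | h | h | h | h | h | h | h | h
  · -- exact prefix: `2(k+1) + 2 < 4N = 2^(m+1)`
    refine value_step hq hR (K := 2 * k + 4) ?_ (by omega) ?_
    · rw [trajN_T0 (by omega), famZ_P1 (by omega)]; push_cast; omega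
    · rw [trajN_T0 (by omega), rneSigMag_of_lt (by rw [hpow1]; omega)]; omega
  · -- `4N` and `4N+2`: representable points of binade 0 (`r = 0`)
    refine value_step hq hR (K := (2 * N + (k + 2 - 2 * N)) * 2 + 0) ?_ (by omega) ?_
    · rw [trajN_T0 (by omega), famZ_P1 (by omega)]; push_cast; omega
    · rw [trajN_T0 (by omega), rneSigMag_binade_step (j := 0) hM h2 (by norm_num) (by omega)
        (by norm_num)]
      simp [stepUp]; omega
  · -- the letter `¼`: a tie from the odd point `v_{0,1}`, resolved up
    obtain rfl : k = 2 * N := by omega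
    refine value_step hq hR (K := (2 * N + 1) * 2 + 1) ?_ (by omega) ?_
    · rw [trajN_T0 le_rfl, famZ_P2]; push_cast; omega
    · rw [trajN_T1 le_rfl (by omega), rneSigMag_binade_step (j := 0) hM h2 (by norm_num)
        (by omega) (by norm_num)]
      simp [stepUp]; omega
  · -- binade 0, letter `¾` from an even point: a tie at spacing `2`, up by two quarters
    refine value_step hq hR (K := (2 * N + (2 * k - 4 * N + 1)) * 2 + 1) ?_ (by omega) ?_
    · rw [trajN_T1 (by omega) (by omega), famZ_B0 (by omega) (by omega)]; push_cast; omega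
    · rw [trajN_T1 (by omega) (by omega), rneSigMag_binade_step (j := 0) hM h2 (by norm_num)
        (by omega) (by norm_num)]
      simp [stepUp]; omega
  · -- the last `¾`: from `v_{1,0} = 8N` (binade 1, spacing 4), `r = 3` exceeds the half-spacing
    obtain rfl : k = 3 * N := by omega
    refine value_step hq hR (K := (2 * N + 0) * 4 + 3) ?_ (by omega) ?_
    · rw [trajN_T1 (by omega) (by omega), famZ_B0 (by omega) (by omega)]; push_cast; omega
    · rw [trajN_T1 (by omega) (by omega), rneSigMag_binade_step (j := 1) hM h2 (by norm_num)
        (by omega) (by norm_num)]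
      simp [stepUp]; omega
  · -- binade 1: `(½, ¾)` pairs — `½` a tie from an odd point, `¾` beyond the half from an even one
    obtain ⟨e, he, hek⟩ : ∃ e, e < 2 * N - 1 ∧ k + 1 = 3 * N + 2 + e := ⟨k + 1 - (3 * N + 2), by omega, by omega⟩
    rcases Nat.mod_two_eq_zero_or_one e with hp | hp
    · refine value_step hq hR (K := (2 * N + (e + 1)) * 4 + 2) ?_ (by omega) ?_
      · rw [trajN_T1 (by omega) (by omega), hek, famZ_B1 N e he, if_pos hp]; push_cast; omega
      · rw [trajN_T1 (by omega) (by omega), rneSigMag_binade_step (j := 1) hM h2 (by norm_num)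
          (by omega) (by norm_num)]
        simp [stepUp]; omega
    · refine value_step hq hR (K := (2 * N + (e + 1)) * 4 + 3) ?_ (by omega) ?_
      · rw [trajN_T1 (by omega) (by omega), hek, famZ_B1 N e he, if_neg (by omega)]; push_cast; omega
      · rw [trajN_T1 (by omega) (by omega), rneSigMag_binade_step (j := 1) hM h2 (by norm_num)
          (by omega) (by norm_num)]
        simp [stepUp]; omega
  · -- binade 2: `(3/2, 1)` pairs, spacing 8
    obtain ⟨e, he, hek⟩ : ∃ e, e < 2 * N ∧ k + 1 = 5 * N + 1 + e := ⟨k + 1 - (5 * N + 1), by omega, by omega⟩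
    rcases Nat.mod_two_eq_zero_or_one e with hp | hp
    · refine value_step hq hR (K := (2 * N + e) * 8 + 6) ?_ (by omega) ?_
      · rw [trajN_T2 hN (by omega) (by omega), hek, famZ_B2 N e he, if_pos hp]; push_cast; omega
      · rw [trajN_T2 hN (by omega) (by omega), rneSigMag_binade_step (j := 2) hM h2 (by norm_num)
          (by omega) (by norm_num)]
        simp [stepUp]; omega
    · refine value_step hq hR (K := (2 * N + e) * 8 + 4) ?_ (by omega) ?_
      · rw [trajN_T2 hN (by omega) (by omega), hek, famZ_B2 N e he, if_neg (by omega)]; push_cast; omega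
      · rw [trajN_T2 hN (by omega) (by omega), rneSigMag_binade_step (j := 2) hM h2 (by norm_num)
          (by omega) (by norm_num)]
        simp [stepUp]; omega
  · -- binade 3: `(9/4, 2)` pairs, spacing 16
    obtain ⟨e, he, hek⟩ : ∃ e, e < 2 * N ∧ k + 1 = 7 * N + 1 + e := ⟨k + 1 - (7 * N + 1), by omega, by omega⟩
    rcases Nat.mod_two_eq_zero_or_one e with hp | hp
    · refine value_step hq hR (K := (2 * N + e) * 16 + 9) ?_ (by omega) ?_
      · rw [trajN_T3 hN (by omega) (by omega), hek, famZ_B3 N e he, if_pos hp]; push_cast; omega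
      · rw [trajN_T3 hN (by omega) (by omega), rneSigMag_binade_step (j := 3) hM h2 (by norm_num)
          (by omega) (by norm_num)]
        simp [stepUp]; omega
    · refine value_step hq hR (K := (2 * N + e) * 16 + 8) ?_ (by omega) ?_
      · rw [trajN_T3 hN (by omega) (by omega), hek, famZ_B3 N e he, if_neg (by omega)]; push_cast; omega
      · rw [trajN_T3 hN (by omega) (by omega), rneSigMag_binade_step (j := 3) hM h2 (by norm_num)
          (by omega) (by norm_num)]
        simp [stepUp]; omega
  · -- binade 4: `(9/2, 4)` pairs, spacing 32
    obtain ⟨e, he, hek⟩ : ∃ e, e < 2 * N ∧ k + 1 = 9 * N + 1 + e := ⟨k + 1 - (9 * N + 1), by omega, by omega⟩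
    rcases Nat.mod_two_eq_zero_or_one e with hp | hp
    · refine value_step hq hR (K := (2 * N + e) * 32 + 18) ?_ (by omega) ?_
      · rw [trajN_T4 hN (by omega) (by omega), hek, famZ_B4 N e he, if_pos hp]; push_cast; omega
      · rw [trajN_T4 hN (by omega) (by omega), rneSigMag_binade_step (j := 4) hM h2 (by norm_num)
          (by omega) (by norm_num)]
        simp [stepUp]; omega
    · refine value_step hq hR (K := (2 * N + e) * 32 + 16) ?_ (by omega) ?_
      · rw [trajN_T4 hN (by omega) (by omega), hek, famZ_B4 N e he, if_neg (by omega)]; push_cast; omega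
      · rw [trajN_T4 hN (by omega) (by omega), rneSigMag_binade_step (j := 4) hM h2 (by norm_num)
          (by omega) (by norm_num)]
        simp [stepUp]; omega
  · -- binade 5: `(9, 8)` pairs, spacing 64
    obtain ⟨e, he, hek⟩ : ∃ e, e < 2 * N ∧ k + 1 = 11 * N + 1 + e := ⟨k + 1 - (11 * N + 1), by omega, by omega⟩
    rcases Nat.mod_two_eq_zero_or_one e with hp | hp
    · refine value_step hq hR (K := (2 * N + e) * 64 + 36) ?_ (by omega) ?_
      · rw [trajN_T5 hN (by omega) (by omega), hek, famZ_B5 N e he, if_pos hp]; push_cast; omega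
      · rw [trajN_T5 hN (by omega) (by omega), rneSigMag_binade_step (j := 5) hM h2 (by norm_num)
          (by omega) (by norm_num)]
        simp [stepUp]; omega
    · refine value_step hq hR (K := (2 * N + e) * 64 + 32) ?_ (by omega) ?_
      · rw [trajN_T5 hN (by omega) (by omega), hek, famZ_B5 N e he, if_neg (by omega)]; push_cast; omega
      · rw [trajN_T5 hN (by omega) (by omega), rneSigMag_binade_step (j := 5) hM h2 (by norm_num)
          (by omega) (by norm_num)]
        simp [stepUp]; omega
  · -- `18` from `v_{6,0} = 256N` (spacing 128): `2·72 > 128`, up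
    obtain rfl : k = 13 * N := by omega
    refine value_step hq hR (K := (2 * N + 0) * 128 + 72) ?_ (by omega) ?_
    · rw [trajN_T5 hN (by omega) le_rfl, famZ_B6a hN]; push_cast; omega
    · rw [trajN_T6 hN, rneSigMag_binade_step (j := 6) hM h2 (by norm_num) (by omega)
        (by norm_num)]
      simp [stepUp]; omega
  · -- `16` from the odd point `v_{6,1}`: a tie resolved up to `v° = (2N+2)·128`
    obtain rfl : k = 13 * N + 1 := by omega
    refine value_step hq hR (K := (2 * N + 1) * 128 + 64) ?_ (by omega) ?_
    · rw [trajN_T6 hN, famZ_B6b hN]; push_cast; omega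
    · rw [trajN_T7 le_rfl, rneSigMag_binade_step (j := 6) hM h2 (by norm_num) (by omega)
        (by norm_num)]
      simp [stepUp]; omega

/-- THE ABSORBED TAIL: at `v° = 64N + 64` the letter `-16` is a downward tie from an even point,
so `fl_φ(v° - 16) = v°`. [cell, gemm.tex Thm. t:thetap (iv)] -/
theorem tail_fix : (roundNE φ ((64 * (N : ℚ) + 64) + (-16))).toRat = 64 * (N : ℚ) + 64 ∧
    |(64 * (N : ℚ) + 64) + (-16)| ≤ φ.maxRat := by
  obtain ⟨hN, hpow, -⟩ := pow_facts hM
  have h2 : 2 ∣ 2 * N := ⟨N, rfl⟩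
  have h := value_step hq hR (a := 256 * N + 256) (c := -64) (K := (2 * N + 1) * 128 + 64)
    (b := 256 * N + 256) (by push_cast; omega) (by omega)
    (by rw [rneSigMag_binade_step (j := 6) hM h2 (by norm_num) (by omega) (by norm_num)]
        simp [stepUp]; omega)
  have e1 : ((256 * N + 256 : ℕ) : ℚ) / 4 + ((-64 : ℤ) : ℚ) / 4 = (64 * (N : ℚ) + 64) + (-16) := by
    push_cast; ring
  have e2 : ((256 * N + 256 : ℕ) : ℚ) / 4 = 64 * (N : ℚ) + 64 := by push_cast; ring
  rw [e1, e2] at h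
  exact h

/-- `ŝ₀ = ½`. [cell] -/
theorem fam_s0 : (seqSum φ (fam N) 0).toRat = traj N 0 := by
  obtain ⟨hN, hpow, hpow1⟩ := pow_facts hM
  show (roundNE φ (fam N 0)).toRat = traj N 0
  unfold fam traj
  rw [famZ_P1 (by omega), trajN_T0 (by omega)]
  have h := roundNE_quarter_nat hq hR (K := 2) (by omega)
  rw [rneSigMag_of_lt (by rw [hpow1]; omega)] at h
  push_cast at h ⊢
  simpa using h

/-- THE ACCUMULATOR FOLLOWS `traj` ALONG THE WHOLE PREFIX. [cell] -/
theorem fam_seqSum : ∀ k ≤ 13 * N + 2, (seqSum φ (fam N) k).toRat = traj N k := by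
  intro k hk
  have h := seqSum_orbitFn (α := φ) (fam N) 0 (13 * N + 2) (fun j => fam N (j + 1)) (traj N)
    (fun j _ => by rw [Nat.zero_add]) (fam_s0 hq hR hM)
    (fun j hj => (traj_step hq hR hM j hj).1) k hk
  rwa [Nat.zero_add] at h

/-- The prefix stays in range. [cell] -/
theorem fam_inRange_prefix : InRange φ (fam N) (13 * N + 2) := by
  obtain ⟨hN, hpow, -⟩ := pow_facts hM
  refine ⟨?_, fun k hk => ?_⟩
  · unfold fam; rw [famZ_P1 (by omega), abs_of_nonneg (by positivity)]
    exact le_trans (by norm_num) (quarter_le_maxRat hR (K := 2) (by omega))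
  · rw [fam_seqSum hq hR hM k (le_of_lt hk)]
    exact (traj_step hq hR hM k hk).2

end Steps

/-! ### The closed form for every length `n ≥ 13N + 3` -/

section Closed

variable (hq : φ.qexp ≤ -2) (hR : (2 : ℚ) ^ (φ.manBits + 10) ≤ φ.maxRat)
  {N : ℕ} (hM : 2 ^ φ.manBits = 2 * N)
include hq hR hM

/-- FOR EVERY `k ≥ 13N+2`: `ŝₖ = 64N + 64`, `Σ = (141N+136)/4 - 16(k - 13N - 2)`,
`Σ|·| = (141N+136)/4 + 16(k - 13N - 2)`. [cell] -/
theorem fam_tail : ∀ k, 13 * N + 2 ≤ k → (seqSum φ (fam N) k).toRat = 64 * (N : ℚ) + 64 ∧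
    ∑ i ∈ range (k + 1), fam N i = (141 * (N : ℚ) + 136) / 4 + ((k : ℚ) - (13 * N + 2 : ℕ)) * (-16) ∧
    ∑ i ∈ range (k + 1), |fam N i| = (141 * (N : ℚ) + 136) / 4 + ((k : ℚ) - (13 * N + 2 : ℕ)) * 16 := by
  obtain ⟨hN, hpow, -⟩ := pow_facts hM
  have hx : ∀ k, 13 * N + 2 < k → fam N k = -16 := by
    intro k hk; unfold fam; rw [famZ_tail (by omega)]; norm_num
  have hS : ∑ i ∈ range (13 * N + 2 + 1), fam N i = (141 * (N : ℚ) + 136) / 4 := by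
    unfold fam
    simp_rw [div_eq_mul_inv]
    rw [← sum_mul]
    congr 1
    exact_mod_cast sum_famZ hN
  have hΛ : ∑ i ∈ range (13 * N + 2 + 1), |fam N i| = (141 * (N : ℚ) + 136) / 4 := by
    rw [← hS]
    refine sum_congr rfl (fun i hi => abs_of_pos ?_)
    unfold fam
    have := famZ_pos (N := N) (k := i) (by have := mem_range.mp hi; omega)
    have : (0 : ℚ) < famZ N i := by exact_mod_cast this
    positivity
  have hv : (seqSum φ (fam N) (13 * N + 2)).toRat = 64 * (N : ℚ) + 64 := by
    rw [fam_seqSum hq hR hM _ le_rfl]; unfold traj; rw [trajN_T7 le_rfl]; push_cast; ring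
  have h := tieChain_spec (α := φ) (fam N) (13 * N + 2) (-16) (64 * (N : ℚ) + 64) _ _ hx hv
    (tail_fix hq hR hM).1 hS hΛ
  intro k hk
  obtain ⟨h1, h2, h3⟩ := h k hk
  refine ⟨h1, by simpa using h2, by rw [h3, abs_of_neg (by norm_num)]; push_cast; ring⟩

/-- The family never leaves the finite range of `φ`. [cell] -/
theorem fam_inRange : ∀ k, InRange φ (fam N) k := by
  refine tieChain_inRange (α := φ) (fam N) (13 * N + 2) (-16) (64 * (N : ℚ) + 64)
    (fun k hk => by unfold fam; rw [famZ_tail (by omega)]; norm_num) ?_ (tail_fix hq hR hM).1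
    (fam_inRange_prefix hq hR hM) (tail_fix hq hR hM).2
  rw [fam_seqSum hq hR hM _ le_rfl]; unfold traj; rw [trajN_T7 le_rfl]; push_cast; ring

/-- THE CLOSED FORM: for every length `n = k + 1 ≥ 13N + 3` the relative error of the family is
`(64n - 717N - 72)/(64n - 691N - 56)`. [cell, gemm.tex Thm. t:thetap (iv)] -/
theorem fam_relErr (k : ℕ) (hk : 13 * N + 2 ≤ k) :
    |(seqSum φ (fam N) k).toRat - ∑ i ∈ range (k + 1), fam N i| / ∑ i ∈ range (k + 1), |fam N i|
      = (64 * ((k : ℚ) + 1) - 717 * N - 72) / (64 * ((k : ℚ) + 1) - 691 * N - 56) := by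
  obtain ⟨h1, h2, h3⟩ := fam_tail hq hR hM k hk
  have hk' : ((13 * N + 2 : ℕ) : ℚ) ≤ k := by exact_mod_cast hk
  have hN0 : (0 : ℚ) ≤ N := Nat.cast_nonneg N
  rw [h1, h2, h3]
  push_cast at hk' ⊢
  have hd1 : (0 : ℚ) < (141 * (N : ℚ) + 136) / 4 + ((k : ℚ) - (13 * (N : ℚ) + 2)) * 16 := by
    nlinarith
  have hd2 : (0 : ℚ) < 64 * ((k : ℚ) + 1) - 691 * N - 56 := by nlinarith
  rw [abs_of_nonneg (by nlinarith), div_eq_div_iff hd1.ne' hd2.ne']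
  ring

/-- Equivalently `1 - (relative error) = (26N + 16)/(64n - 691N - 56)` — the numerator is
`64·θ_p`. [cell, gemm.tex Thm. t:thetap (iv)–(v)] -/
theorem fam_defect (k : ℕ) (hk : 13 * N + 2 ≤ k) :
    1 - |(seqSum φ (fam N) k).toRat - ∑ i ∈ range (k + 1), fam N i| / ∑ i ∈ range (k + 1), |fam N i|
      = (26 * (N : ℚ) + 16) / (64 * ((k : ℚ) + 1) - 691 * N - 56) := by
  rw [fam_relErr hq hR hM k hk]
  have hk' : ((13 * N + 2 : ℕ) : ℚ) ≤ k := by exact_mod_cast hk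
  push_cast at hk'
  have hden : (64 * ((k : ℚ) + 1) - 691 * N - 56) ≠ 0 := by
    have : (0 : ℚ) ≤ N := Nat.cast_nonneg N
    exact (by nlinarith : (0 : ℚ) < 64 * ((k : ℚ) + 1) - 691 * N - 56).ne'
  rw [eq_div_iff hden, sub_mul, div_mul_cancel₀ _ hden]
  ring

end Closed

end Summit.Ventures.CertifiedArithmetic.LowPrec.Gemm
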